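import Mathlib
import Summits.ValiantsHypothesis.ValiantsHypothesis.Theorems.GeneratorObstructionsPowGenDegreeQPNullconeDegree
import Summits.ValiantsHypothesis.ValiantsHypothesis.Theorems.GeneratorObstructionsPerGenDegreeSuperQPMinimalDegree
import Literature.Computability.AlgebraicComplexity.BI17HoweInvariantsProofs

/-!
# Route GeneratorObstructions — crux K2 `PowGenDegreeQP` (stmt-ValiantsHypothesis-11655), line
# `trace-side-regimes`: the PARITY refinement — for odd `m` the least constant weight is `≥ m + 1`

Helper file (`--supports stmt-ValiantsHypothesis-11655`).  The least occurring constant weight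
`-k₀·𝟙` of `ℂ[Δ_m[tr X_{m+e}^m]]` is a generator type with `m ≤ k₀` (`exists_least_const_genType`).
Howe's theorem (BI 2017 Thm. 3.14/3.21 context; tree `slInvariantsOfDegree_self_eq_bot_of_odd`:
`Sym^m ℂ^N` has NO `SL_N`-invariant of degree `N` when `m` is odd, `N ≥ 2`) excludes `k₀ = m` for
odd `m` — the constant weight `-m·𝟙_N` lives in degree `N` and would be the restriction of such an
invariant (tree `exists_mem_degreeMonoid_of_hasHighestWeight_const`):

* `not_hasHighestWeight_const_self_of_odd` — `Fin N` model, any form `p` of odd degree `m` on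
  `N ≥ 2` letters: `-m·𝟙` does not occur in `ℂ[Δ_m p]`;
* `powFormLex_highestWeightSpace_const_self_eq_bot_of_odd` — transported to `tr X_n^m` in the
  lexicographic matrix letters (`n ≥ 2`, `m` odd);
* `exists_least_const_genType_odd` — hence for odd `m ≥ 3` and every cell `(m, e)` the least
  constant-weight generator type of `A(Δ_m[tr X_{m+e}^m])` has `m + 1 ≤ k₀`, i.e. degree
  `k₀ (m+e)²/m ≥ (m+1)(m+e)²/m`: the nullcone-separation degree of an odd power trace exceeds `n²`.

Honest framing: a parity footnote to the calibration; `stub_sliceGen`, `stub_wideGen`, K2 remain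
OPEN; `VP ≠ VNP` untouched.  References: [BurgisserIkenmeyer2017] Thm. 3.14, Thm. 3.21 (Howe);
R. Howe, *(GL_n, GL_m)-duality and symmetric plethysm*, Proc. Indian Acad. Sci. 97 (1987).
-/

namespace Summit.ValiantsHypothesis.ValiantsHypothesis.Theorems.GeneratorObstructions.PowGenDegreeQP

open MvPolynomial
open Literature.NumberTheory.DiophantineGeometry Literature.Computability.AlgebraicComplexity
open Summit.ValiantsHypothesis.ValiantsHypothesis.Theses.GeneratorObstructions
open Summit.ValiantsHypothesis.ValiantsHypothesis.Theorems.GenInheritance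
open Summit.ValiantsHypothesis.ValiantsHypothesis.Theorems.GeneratorObstructions.SliceTransfer
open Summit.ValiantsHypothesis.ValiantsHypothesis.Theorems.GeneratorObstructions.PerGenDegreeSuperQP

-- `Summit.ValiantsHypothesis.ValiantsHypothesis.…` is the tree's mandated single-conjunct layout.
set_option linter.dupNamespace false

noncomputable section

/-- **No occurring constant weight `-m·𝟙` for forms of odd degree `m`** (`Fin N` model, `N ≥ 2`):
if it occurred in `ℂ[Δ_m p]`, a highest-weight vector of that weight outside `I(GL·p)` would be a
nonzero `SL_N`-invariant of degree `d` with `N·m = m·d`, i.e. `d = N`, of `Sym^m ℂ^N` — but for odd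
`m` there is none (Howe; tree `slInvariantsOfDegree_self_eq_bot_of_odd`). [cite: BurgisserIkenmeyer2017, Thm. 3.21] -/
theorem not_hasHighestWeight_const_self_of_odd {N m : ℕ} (hN : 2 ≤ N) (hm : Odd m)
    (p : MvPolynomial (Fin N) ℂ) :
    ¬ HasHighestWeight (orbitCoordRep p m) (fun _ : Fin N => -(m : ℤ)) := by
  intro h
  have hm0 : 0 < m := hm.pos
  obtain ⟨d, hNd, hd, F, hFh, hFi, hFI⟩ :=
    exists_mem_degreeMonoid_of_hasHighestWeight_const (by omega) (by omega) p hm0 h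
  have hdN : d = N := by
    have : m * d = m * N := by rw [← hNd, mul_comm]
    exact Nat.eq_of_mul_eq_mul_left hm0 this
  subst hdN
  have hmem : F ∈ slInvariantsOfDegree (Fin d) ℂ m d :=
    (mem_slInvariantsOfDegree_iff m d F).mpr ⟨hFh, hFi⟩
  rw [slInvariantsOfDegree_self_eq_bot_of_odd hm hN, Submodule.mem_bot] at hmem
  exact hFI (hmem ▸ Ideal.zero_mem _)

/-- **`-m·𝟙` does not occur in `ℂ[Δ_m[tr X_n^m]]` for odd `m`** (`n ≥ 2`, lexicographic matrix
letters): transport of `not_hasHighestWeight_const_self_of_odd` along `Fin (n·n) → MatIdx n`.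
[cite: BurgisserIkenmeyer2017, Thm. 3.21] -/
theorem powFormLex_highestWeightSpace_const_self_eq_bot_of_odd {n m : ℕ} (hn : 2 ≤ n) (hm : Odd m) :
    highestWeightSpace (orbitCoordRep (powFormLex ℂ n m) m) (fun _ : MatIdx n => -(m : ℤ)) = ⊥ := by
  classical
  by_contra hne
  set e : Fin n × Fin n ≃ Fin (n * n) := finProdFinEquiv with he
  set p : MvPolynomial (Fin (n * n)) ℂ := rename e (powTrace ℂ n m) with hpdef
  set κ : Fin (n * n) → MatIdx n := fun i => toLex (e.symm i) with hκ
  have hκinj : Function.Injective κ := fun i j hij => e.symm.injective (toLex.injective hij)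
  have key := hasHighestWeight_orbitCoordRep_rename_dualOfPartition_iff (k := ℂ) (m := m)
    (matIdxEquiv n) κ hκinj p (by have := hm.pos; omega) (Nat.Partition.rectangle (n * n) m)
    (Nat.Partition.card_parts_rectangle_le (n * n) m)
  rw [dualOfPartition_rectangle_self, hκ, hpdef, he, rename_powTraceFin_eq_powFormLex n m] at key
  have hHW : HasHighestWeight (orbitCoordRep (powFormLex ℂ n m) m) (fun _ : MatIdx n => -(m : ℤ)) := hne
  exact not_hasHighestWeight_const_self_of_odd (N := n * n) (by nlinarith) hm _ (key.mp hHW)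

/-- **Parity refinement of the least constant-weight generator type.** For odd `m ≥ 3` and every
cell `(m, e)` the least `k₀` with `-k₀·𝟙` occurring in `ℂ[Δ_m[tr X_{m+e}^m]]` satisfies `m + 1 ≤ k₀`
(it is `≥ m` by `ℓ(λ) ≤ deg`, and `≠ m` by Howe); the corresponding generator type has degree
`k₀ (m+e)²/m ≥ (m+1)(m+e)²/m > (m+e)²`. [cite: BurgisserIkenmeyer2017, Thm. 3.21] -/
theorem exists_least_const_genType_odd {m : ℕ} (hm : 3 ≤ m) (hodd : Odd m) (e : ℕ) :
    ∃ k₀ : ℕ, m + 1 ≤ k₀ ∧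
      highestWeightSpace (orbitCoordRep (powFormLex ℂ (m + e) m) m) (fun _ => -(k₀ : ℤ)) ≠ ⊥ ∧
      (∀ k : ℕ, 0 < k → k < k₀ →
        highestWeightSpace (orbitCoordRep (powFormLex ℂ (m + e) m) m) (fun _ => -(k : ℤ)) = ⊥) ∧
      Module.finrank ℂ (↥(highestWeightSpace (orbitCoordRep (powFormLex ℂ (m + e) m) m) (fun _ => -(k₀ : ℤ))) ⧸
        Submodule.comap (highestWeightSpace (orbitCoordRep (powFormLex ℂ (m + e) m) m) (fun _ => -(k₀ : ℤ))).subtype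
          (⨆ p : Weight (MatIdx (m + e)) × Weight (MatIdx (m + e)),
            ⨆ (_ : p.1 + p.2 = (fun _ => -(k₀ : ℤ)) ∧ p.1 ≠ 0 ∧ p.2 ≠ 0),
            highestWeightSpace (orbitCoordRep (powFormLex ℂ (m + e) m) m) p.1 *
              highestWeightSpace (orbitCoordRep (powFormLex ℂ (m + e) m) m) p.2)) ≠ 0 := by
  obtain ⟨k₀, hk₀, hocc, hmin, hγ⟩ := exists_least_const_genType (show 2 ≤ m by omega) e
  refine ⟨k₀, ?_, hocc, hmin, hγ⟩
  rcases Nat.lt_or_ge m k₀ with hlt | hge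
  · omega
  · have hk : k₀ = m := le_antisymm hge hk₀
    subst hk
    exact absurd (powFormLex_highestWeightSpace_const_self_eq_bot_of_odd (n := k₀ + e) (by omega) hodd) hocc

/-- **K2 ⇒ for odd `m` the (qp-bounded) nullcone-separation degree is at least `(m+1)(m+e)²/m`**:
under `PowGenDegreeQP`, for every `c` some `c₀` with `(m+1)(m+e)² ≤ m · 2^((log₂ m + c₀)^c₀)` for all
odd `m ≥ 3` and `m + e ≤ 2^((log₂ m + c)^c)` — the window bound must absorb the parity jump.
[cite: BurgisserIkenmeyer2017, Thm. 3.21] -/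
theorem powGenDegreeQP_odd_bound (hK2 : PowGenDegreeQP) :
    ∀ c : ℕ, ∃ c₀ : ℕ, ∀ m e : ℕ, 3 ≤ m → Odd m → m + e ≤ 2 ^ ((Nat.log 2 m + c) ^ c) →
      ((m + 1 : ℕ) : ℤ) * (((m + e) * (m + e) : ℕ) : ℤ) ≤ (m : ℤ) * 2 ^ ((Nat.log 2 m + c₀) ^ c₀) := by
  intro c
  obtain ⟨c₀, hc₀⟩ := hK2 c
  refine ⟨c₀, fun m e hm hodd hwin => ?_⟩
  obtain ⟨k₀, hk₀, -, -, hγ⟩ := exists_least_const_genType_odd hm hodd e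
  have hb := hc₀ m e (by omega) hwin _ hγ
  rw [size_const_neg, Fintype.card_lex, Fintype.card_prod, Fintype.card_fin, neg_neg] at hb
  push_cast at hb ⊢
  have hk : ((m : ℤ) + 1) ≤ (k₀ : ℤ) := by exact_mod_cast hk₀
  nlinarith

end

end Summit.ValiantsHypothesis.ValiantsHypothesis.Theorems.GeneratorObstructions.PowGenDegreeQP
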